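import Literature.AlgebraicGeometry.Ramification.MonomialDivisors
import Literature.AlgebraicGeometry.Resolution.RsopMonomialIdeals
import Literature.AlgebraicGeometry.Resolution.RegularLocalRingsUFD
import Mathlib.RingTheory.Localization.NumDen
import Mathlib.RingTheory.UniqueFactorizationDomain.Basic
import Mathlib.Algebra.BigOperators.Associated
import Mathlib.Algebra.CharP.Algebra
import HarnessLib

/-!
# The refined Swan conductor does not depend on the normal form (Kato 1989 §3; Kato 1994 (3.4.2))

Topic: `Literature/AlgebraicGeometry/Ramification`. Companion to `KatoCleanRamification.lean`
(definition request `defn-KatoCleanRamification`): there the refined Swan conductor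
`rsw(χ)_x ∈ Ω¹_A(log D) ⊗ 𝒪_{Z,x}` of an Artin–Schreier class `χ = [f]` at a point of a strict
normal crossings divisor `D = V(z₁⋯z_n)` was rendered through a NORMAL FORM `f - ℘(g) = u/z^R`
(`rswForm z R u = -(du - uΣRᵢ dlog zᵢ)`, `refinedSwanConductor z R u` = its class modulo
`I_Z · Ω¹_A(log D)`, `I_Z = (∏_{Rᵢ≠0} zᵢ)`), and Kato-cleanliness at `x` was defined with an
existential over normal forms. This file PROVES what Kato's sheaf-theoretic construction has built
in (the morphism `gr_R j_*𝒪_U → gr_R j_*Ω¹_U = Ω¹_X(log D)(R) ⊗ 𝒪_Z` is well defined on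
`gr_R R¹(εj)_*ℤ/p`, Kato 1989 Thm. (3.2) / Yatagawa 2022 Prop. 1.16): two normal forms of the same
class with the same exponent vector `R` have the same refined Swan conductor, for `A` a unique
factorisation domain (e.g. a regular local ring, Auslander–Buchsbaum) and `z₁,…,z_n` pairwise
non-associated prime elements (e.g. part of a regular system of parameters).

## The argument (Kato 1989 §3, made explicit)

If `u/z^R` and `u'/z^R` differ by `℘(h)`, `h ∈ K = Frac A`, write `h = a/c` in lowest terms;
`z^R (a^p - a c^{p-1}) = (u - u') c^p` and `gcd(c, a^p - a c^{p-1}) = 1` give `c^p ∣ z^R`, so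
`c ∼ z^r` with `p·r ≤ R` and `h = w/z^r`, `w ∈ A` (`exists_mul_monomial_eq_of_artinSchreier`). Then
`u - u' = w^p z^{R-pr} - w z^{R-r}` and
`rsw(u) - rsw(u') = -w^p z^{R-pr} Σ (Rᵢ - prᵢ - Rᵢ) dlog zᵢ + z^{R-r}(dw - wΣ rᵢ dlog zᵢ)`; the first
term vanishes in characteristic `p` and `z^{R-r} ∈ I_Z` because `rᵢ < Rᵢ` whenever `Rᵢ ≠ 0`
(`rswForm_sub_mem_of_mul_monomial_eq`).

## Results

* `exists_mul_monomial_eq_of_artinSchreier` (the key arithmetic lemma; divisors of monomials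
  in non-associated primes are in `MonomialDivisors.lean`);
* `LogDifferential.d_monomial`, `rswForm_add/neg/sub`, `rswForm_mul_monomial` (calculus);
* `rswForm_sub_mem_of_mul_monomial_eq`, `refinedSwanConductor_eq_of_mul_monomial_eq`
  (INDEPENDENCE), `rswForm_not_mem_of_isCleanAt` ("some normal form" ⇒ "every normal form" in
  `IsCleanAt`), and the same for `z` part of a regular system of parameters of a regular local
  ring, `IsRsopPart.rswForm_not_mem_of_isCleanAt`.

## Sources

* K. Kato, Contemp. Math. 83 (1989), §3, Thm. (3.2). [Kato1989]
* K. Kato, Amer. J. Math. 116 (1994), (3.4.2). [Kato1994Ramification]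
* Y. Yatagawa, arXiv:2206.02989 (2022), Lemma 1.15, Prop. 1.16, Rem. 1.23 (2). [Yatagawa2022]
-/

noncomputable section

namespace Literature.AlgebraicGeometry.Ramification

universe u v

open IsLocalRing

/-! ## The denominator of an Artin–Schreier translate -/

section UFD

variable {A : Type u} [CommRing A] [IsDomain A] [UniqueFactorizationMonoid A] {n : ℕ}
  {z : Fin n → A}

/-- **The key arithmetic lemma** (Kato 1989 §3): if `z^R · ℘(h) ∈ A` for `h` in the fraction field,
then `h = w / z^r` with `w ∈ A` and `p·r ≤ R` — the denominator of `h` is a `p`-th root of a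
divisor of `z^R`. [cite: Kato1989, §3] -/
theorem exists_mul_monomial_eq_of_artinSchreier {K : Type v} [Field K] [Algebra A K]
    [IsFractionRing A K] (p : ℕ) [hp : Fact p.Prime] (hz : ∀ i, Prime (z i))
    (hza : ∀ i j, i ≠ j → ¬Associated (z i) (z j)) (R : Fin n → ℕ) {h : K} {b : A}
    (hb : algebraMap A K (monomial z R) * artinSchreier p h = algebraMap A K b) :
    ∃ (w : A) (r : Fin n → ℕ), (∀ i, p * r i ≤ R i) ∧
      h * algebraMap A K (monomial z r) = algebraMap A K w := by
  obtain ⟨a, c, hrel, rfl⟩ := IsFractionRing.exists_reduced_fraction (A := A) h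
  have hc0 : (c : A) ≠ 0 := nonZeroDivisors.coe_ne_zero c
  have hγ : algebraMap A K c ≠ 0 :=
    fun e => hc0 (IsFractionRing.injective A K (by rw [e, map_zero]))
  have hp1 : p - 1 + 1 = p := Nat.sub_add_cancel hp.out.one_le
  -- clearing denominators: `z^R (a^p - a c^(p-1)) = b c^p`
  have key : monomial z R * (a ^ p - a * (c : A) ^ (p - 1)) = b * (c : A) ^ p := by
    apply IsFractionRing.injective A K
    have e1 : (algebraMap A K a / algebraMap A K c) ^ p * algebraMap A K c ^ p =
        algebraMap A K a ^ p := by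
      rw [div_pow, div_mul_cancel₀ _ (pow_ne_zero _ hγ)]
    have e2 : algebraMap A K a / algebraMap A K c * algebraMap A K c ^ p =
        algebraMap A K a * algebraMap A K c ^ (p - 1) := by
      conv_lhs => rw [← hp1, pow_succ, mul_comm (algebraMap A K c ^ (p - 1)), ← mul_assoc,
        div_mul_cancel₀ _ hγ]
    simp only [map_mul, map_sub, map_pow]
    rw [← hb, IsFractionRing.mk'_eq_div, artinSchreier_def, mul_assoc, sub_mul, e1, e2]
  have hdvd : (c : A) ^ p ∣ monomial z R * (a ^ p - a * (c : A) ^ (p - 1)) :=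
    ⟨b, by rw [key, mul_comm]⟩
  -- `c^p` and `a^p - a c^(p-1)` have no common prime factor
  have hcop : ∀ ⦃d : A⦄, d ∣ (c : A) ^ p → d ∣ a ^ p - a * (c : A) ^ (p - 1) → ¬Prime d := by
    intro d hdc hdT hd
    have hdc' : d ∣ (c : A) := hd.dvd_of_dvd_pow hdc
    have hp1' : p - 1 ≠ 0 := by have := hp.out.two_le; omega
    have hda : d ∣ a ^ p := by
      have : d ∣ a * (c : A) ^ (p - 1) := (dvd_pow hdc' hp1').mul_left a
      simpa using dvd_add hdT this
    exact hd.not_unit (hrel (hd.dvd_of_dvd_pow hda) hdc')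
  have hcR : (c : A) ^ p ∣ monomial z R :=
    UniqueFactorizationMonoid.dvd_of_dvd_mul_left_of_no_prime_factors (pow_ne_zero _ hc0) hcop hdvd
  -- `c ∼ z^s`, `p s ≤ R`
  obtain ⟨s, -, hs⟩ := exists_associated_monomial_of_dvd hz R Finset.univ c
    ((dvd_pow_self (c : A) hp.out.ne_zero).trans hcR)
  have hps : ∀ i, p * s i ≤ R i := by
    have hassoc : Associated ((c : A) ^ p) (monomial z (p • s)) := by
      rw [monomial_nsmul]; exact hs.pow_pow
    intro i
    simpa using le_of_monomial_dvd_monomial hz hza (hassoc.dvd_iff_dvd_left.mp hcR) i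
  obtain ⟨v, hv⟩ := hs
  refine ⟨a * v, s, hps, ?_⟩
  rw [show monomial z s = ∏ i, z i ^ s i from rfl, ← hv, map_mul, ← mul_assoc,
    IsLocalization.mk'_spec, map_mul]

end UFD

/-! ## Calculus of `rswForm` -/

section Calculus

variable {A : Type u} [CommRing A] {n : ℕ} (z : Fin n → A)

/-- `d(zᵢ^m) = m zᵢ^m dlog zᵢ`. [folklore] -/
theorem LogDifferential.d_z_pow (i : Fin n) (m : ℕ) :
    LogDifferential.d A z (z i ^ m) = ((m : A) * z i ^ m) • LogDifferential.dlog A z i := by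
  rcases m with _ | m
  · simp
  · rw [Derivation.leibniz_pow, LogDifferential.d_apply_z, smul_smul, ← Nat.cast_smul_eq_nsmul A,
      smul_smul, Nat.add_sub_cancel, pow_succ, Nat.cast_succ]

/-- `d(z^m) = z^m Σ mᵢ dlog zᵢ` (over a sub-product). [folklore] -/
theorem LogDifferential.d_prod_z_pow (m : Fin n → ℕ) (S : Finset (Fin n)) :
    LogDifferential.d A z (∏ i ∈ S, z i ^ m i) =
      ∑ i ∈ S, ((m i : A) * ∏ j ∈ S, z j ^ m j) • LogDifferential.dlog A z i := by
  classical
  induction S using Finset.induction with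
  | empty => simp
  | insert a S haS ih =>
    rw [Finset.prod_insert haS, Derivation.leibniz, ih, LogDifferential.d_z_pow,
      Finset.sum_insert haS, Finset.smul_sum, add_comm]
    congr 1
    · rw [smul_smul]; congr 1; ring
    · refine Finset.sum_congr rfl fun i _ => ?_
      rw [smul_smul]; congr 1; ring

/-- `d(z^m) = z^m Σ mᵢ dlog zᵢ`. [folklore] -/
theorem LogDifferential.d_monomial (m : Fin n → ℕ) :
    LogDifferential.d A z (monomial z m) =
      ∑ i, ((m i : A) * monomial z m) • LogDifferential.dlog A z i :=
  LogDifferential.d_prod_z_pow z m Finset.univ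

/-- `rswForm` is additive in `u`. [folklore] -/
theorem rswForm_add (R : Fin n → ℕ) (u v : A) :
    rswForm z R (u + v) = rswForm z R u + rswForm z R v := by
  simp only [rswForm, map_add, add_smul]
  abel

/-- `rswForm` is compatible with negation. [folklore] -/
theorem rswForm_neg (R : Fin n → ℕ) (u : A) : rswForm z R (-u) = -rswForm z R u := by
  simp only [rswForm, map_neg, neg_smul]
  abel

/-- `rswForm` is compatible with subtraction. [folklore] -/
theorem rswForm_sub (R : Fin n → ℕ) (u v : A) :
    rswForm z R (u - v) = rswForm z R u - rswForm z R v := by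
  rw [sub_eq_add_neg, rswForm_add, rswForm_neg, ← sub_eq_add_neg]

/-- **`rsw` of a monomial multiple**: `rsw_R(w z^m) = -z^m (dw + w Σ (mᵢ - Rᵢ) dlog zᵢ)`.
[folklore] -/
theorem rswForm_mul_monomial (R m : Fin n → ℕ) (w : A) :
    rswForm z R (w * monomial z m) =
      -(monomial z m • (LogDifferential.d A z w +
          w • ∑ i, ((m i : A) - (R i : A)) • LogDifferential.dlog A z i)) := by
  rw [rswForm, Derivation.leibniz, LogDifferential.d_monomial, Finset.smul_sum, Finset.smul_sum,
    smul_add, Finset.smul_sum, Finset.smul_sum]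
  congr 1
  rw [sub_eq_iff_eq_add, add_assoc, ← Finset.sum_add_distrib, add_comm]
  congr 1
  refine Finset.sum_congr rfl fun i _ => ?_
  simp only [smul_smul, ← add_smul]
  congr 1
  ring

/-- In characteristic `p`, `rsw_R(w^p z^(R - p r)) = 0` (for `p r ≤ R`): `d(w^p) = 0` and the
`dlog` coefficients `(Rᵢ - prᵢ) - Rᵢ = -prᵢ` vanish. [folklore] -/
theorem rswForm_pow_mul_monomial_eq_zero (p : ℕ) [CharP A p] {R r : Fin n → ℕ}
    (hr : ∀ i, p * r i ≤ R i) (w : A) :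
    rswForm z R (w ^ p * monomial z (R - p • r)) = 0 := by
  rw [rswForm_mul_monomial]
  have hd : LogDifferential.d A z (w ^ p) = 0 := by
    rw [Derivation.leibniz_pow, ← Nat.cast_smul_eq_nsmul A, CharP.cast_eq_zero, zero_smul]
  have hc : ∀ i, ((R i - p * r i : ℕ) : A) - (R i : A) = 0 := by
    intro i
    rw [Nat.cast_sub (hr i), Nat.cast_mul, CharP.cast_eq_zero A p, zero_mul, sub_zero, sub_self]
  have hsum : ∑ i, ((((R - p • r) i : ℕ) : A) - (R i : A)) • LogDifferential.dlog A z i = 0 :=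
    Finset.sum_eq_zero fun i _ => by
      rw [show (((R - p • r) i : ℕ) : A) = ((R i - p * r i : ℕ) : A) by rfl, hc, zero_smul]
  rw [hd, hsum, smul_zero, zero_add, smul_zero, neg_zero]

/-- `rsw_R(w z^(R-r)) ∈ I_Z · Ω¹_A(log D)` when `rᵢ < Rᵢ` wherever `Rᵢ ≠ 0` (then
`z^(R-r) ∈ I_Z`). [folklore] -/
theorem rswForm_mul_monomial_mem {R r : Fin n → ℕ} (hr : ∀ i, R i ≠ 0 → r i < R i) (w : A) :
    rswForm z R (w * monomial z (R - r)) ∈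
      wildSupportIdeal z R • (⊤ : Submodule A (LogDifferential A z)) := by
  rw [rswForm_mul_monomial]
  refine Submodule.neg_mem _ (Submodule.smul_mem_smul ?_ Submodule.mem_top)
  exact monomial_mem_wildSupportIdeal z R _ fun i hi => by
    have := hr i hi; simp only [Pi.sub_apply]; omega

end Calculus

/-! ## Independence of the refined Swan conductor from the normal form -/

section Independence

variable {A : Type u} [CommRing A] [IsDomain A] [UniqueFactorizationMonoid A] {n : ℕ}
  {z : Fin n → A} {K : Type v} [Field K] [Algebra A K] [IsFractionRing A K]
  (p : ℕ) [hp : Fact p.Prime] [CharP A p]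

/-- **Well-definedness of `rsw` (Kato).** In a unique factorisation domain `A` with fraction field
`K` of characteristic `p`, for pairwise non-associated primes `z₁,…,z_n` and two normal forms
`(f - ℘g) z^R = u`, `(f - ℘g') z^R = u'` of the same Artin–Schreier class with the same exponent
vector `R`, the refined Swan conductor forms differ by an element of `I_Z · Ω¹_A(log D)`,
`I_Z = (∏_{Rᵢ≠0} zᵢ)`. [cite: Kato1989, Thm. (3.2)] -/
theorem rswForm_sub_mem_of_mul_monomial_eq (hz : ∀ i, Prime (z i))
    (hza : ∀ i j, i ≠ j → ¬Associated (z i) (z j)) (R : Fin n → ℕ) {f g g' : K} {u u' : A}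
    (hu : (f - artinSchreier p g) * algebraMap A K (monomial z R) = algebraMap A K u)
    (hu' : (f - artinSchreier p g') * algebraMap A K (monomial z R) = algebraMap A K u') :
    rswForm z R u - rswForm z R u' ∈
      wildSupportIdeal z R • (⊤ : Submodule A (LogDifferential A z)) := by
  haveI : CharP K p := charP_of_injective_algebraMap (IsFractionRing.injective A K) p
  -- `z^R ℘(g' - g) = u - u'`
  have hb : algebraMap A K (monomial z R) * artinSchreier p (g' - g) = algebraMap A K (u - u') := by
    rw [map_sub, ← hu, ← hu', artinSchreier_sub p]
    ring
  obtain ⟨w, r, hr, hw⟩ := exists_mul_monomial_eq_of_artinSchreier p hz hza R hb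
  have hrle : ∀ i, r i ≤ R i := fun i =>
    le_trans (Nat.le_mul_of_pos_left (r i) hp.out.pos) (hr i)
  have hprle : ∀ i, (p • r) i ≤ R i := fun i => by simpa using hr i
  have hM0 : algebraMap A K (monomial z r) ≠ 0 := by
    intro e
    have hne : monomial z r ≠ 0 :=
      Finset.prod_ne_zero_iff.mpr fun i _ => pow_ne_zero _ (hz i).ne_zero
    exact hne (IsFractionRing.injective A K (by rw [e, map_zero]))
  -- the identity `u - u' = w^p z^(R - p r) - w z^(R - r)` in `A`
  have hid : u - u' = w ^ p * monomial z (R - p • r) - w * monomial z (R - r) := by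
    apply IsFractionRing.injective A K
    have hh : g' - g = algebraMap A K w / algebraMap A K (monomial z r) := by
      rw [eq_div_iff hM0, hw]
    have e1 : algebraMap A K (monomial z R) =
        algebraMap A K (monomial z (R - p • r)) * algebraMap A K (monomial z r) ^ p := by
      rw [monomial_eq_mul_of_le z hprle, monomial_nsmul, map_mul, map_pow]
    have e2 : algebraMap A K (monomial z R) =
        algebraMap A K (monomial z (R - r)) * algebraMap A K (monomial z r) := by
      rw [monomial_eq_mul_of_le z hrle, map_mul]
    rw [← hb, hh, artinSchreier_def, mul_sub, map_sub, map_mul, map_mul, map_pow]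
    congr 1
    · rw [e1, div_pow, mul_assoc, mul_div_cancel₀ _ (pow_ne_zero _ hM0), mul_comm]
    · rw [e2, mul_assoc, mul_div_cancel₀ _ hM0, mul_comm]
  rw [← rswForm_sub, hid, rswForm_sub, rswForm_pow_mul_monomial_eq_zero z p hr, zero_sub]
  refine Submodule.neg_mem _ (rswForm_mul_monomial_mem z (fun i hi => ?_) w)
  -- `rᵢ < Rᵢ` when `Rᵢ ≠ 0`, since `p rᵢ ≤ Rᵢ` and `p ≥ 2`
  have h2 := hp.out.two_le
  have := hr i
  by_contra hcon
  push Not at hcon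
  have : p * r i ≥ 2 * R i := le_trans (Nat.mul_le_mul h2 hcon) le_rfl
  omega

/-- **Independence of the refined Swan conductor from the normal form** (Kato 1994 (3.4.2);
Yatagawa 2022 Prop. 1.16, Rem. 1.23 (2)): same hypotheses, equal classes in
`Ω¹_A(log D) ⊗ 𝒪_Z`. [cite: Kato1994Ramification, (3.4.2)] -/
theorem refinedSwanConductor_eq_of_mul_monomial_eq (hz : ∀ i, Prime (z i))
    (hza : ∀ i j, i ≠ j → ¬Associated (z i) (z j)) (R : Fin n → ℕ) {f g g' : K} {u u' : A}
    (hu : (f - artinSchreier p g) * algebraMap A K (monomial z R) = algebraMap A K u)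
    (hu' : (f - artinSchreier p g') * algebraMap A K (monomial z R) = algebraMap A K u') :
    refinedSwanConductor z R u = refinedSwanConductor z R u' :=
  (Submodule.Quotient.eq _).mpr (rswForm_sub_mem_of_mul_monomial_eq p hz hza R hu hu')

/-- **"Some normal form" = "every normal form" in `IsCleanAt`.** For `A` local (a UFD with
`zᵢ ∈ 𝔪` pairwise non-associated primes): if the class of `f` is Kato-clean at the closed point
and wild there (some `swᵢ ≠ 0`), then EVERY normal form `u'` has non-vanishing refined Swan
conductor at the closed point. [cite: Kato1994Ramification, (3.4.3)] -/
theorem rswForm_not_mem_of_isCleanAt [IsLocalRing A] (hz : ∀ i, Prime (z i))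
    (hza : ∀ i j, i ≠ j → ¬Associated (z i) (z j)) (hzm : ∀ i, z i ∈ maximalIdeal A) {f : K}
    (hclean : IsCleanAt p z f) (hwild : ∃ i, conductorVector p z f i ≠ 0) {u' : A}
    (hu' : IsNormalForm p z f u') :
    rswForm z (conductorVector p z f) u' ∉
      (maximalIdeal A • (⊤ : Submodule A (LogDifferential A z))) := by
  obtain ⟨i, hi⟩ := hwild
  obtain ⟨u, ⟨g, hu⟩, hne⟩ := hclean.resolve_left (fun h => hi (h i))
  obtain ⟨g', hu'⟩ := hu'
  intro hmem
  apply hne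
  have hdiff := rswForm_sub_mem_of_mul_monomial_eq p hz hza (conductorVector p z f) hu hu'
  have hle : wildSupportIdeal z (conductorVector p z f) • (⊤ : Submodule A (LogDifferential A z)) ≤
      maximalIdeal A • ⊤ :=
    Submodule.smul_mono (wildSupportIdeal_le_maximalIdeal z hzm hi) le_rfl
  simpa using Submodule.add_mem _ (hle hdiff) hmem

end Independence

/-! ## The case of a regular local ring -/

section Regular

open Literature.AlgebraicGeometry.Resolution

variable {A : Type u} [CommRing A] [IsLocalRing A] {n : ℕ} {z : Fin n → A}
  {K : Type v} [Field K] [Algebra A K] [IsFractionRing A K] (p : ℕ) [Fact p.Prime] [CharP A p]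

/-- For `z₁,…,z_n` part of a regular system of parameters of the regular local ring `A = 𝒪_{X,x}`
(the situation of `IsStrictNormalCrossingsDivisor`; `A` is then a UFD by Auslander–Buchsbaum and
the `zᵢ` are pairwise non-associated primes in `𝔪`), Kato-cleanliness at a wild point means that
EVERY normal form has non-vanishing refined Swan conductor at `x`.
[cite: Kato1994Ramification, (3.4.3)] -/
theorem _root_.Literature.AlgebraicGeometry.Resolution.IsRsopPart.rswForm_not_mem_of_isCleanAt
    (hzr : IsRsopPart z) {f : K}
    (hclean : IsCleanAt p z f) (hwild : ∃ i, conductorVector p z f i ≠ 0) {u' : A}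
    (hu' : IsNormalForm p z f u') :
    rswForm z (conductorVector p z f) u' ∉
      (maximalIdeal A • (⊤ : Submodule A (LogDifferential A z))) := by
  haveI := hzr.isRegularLocalRing
  haveI := isDomain_of_isRegularLocalRing A
  haveI := IsRegularLocalRing.uniqueFactorizationMonoid A
  exact Literature.AlgebraicGeometry.Ramification.rswForm_not_mem_of_isCleanAt p hzr.prime
    (fun i j hij => hzr.not_associated hij) hzr.mem_maximalIdeal hclean hwild hu'

/-- Consequently, at a wild point and for `z` part of a regular system of parameters, `IsCleanAt`
is equivalent to its universally quantified form: a normal form exists and every normal form has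
`rsw(x) ≠ 0`. [cite: Kato1994Ramification, (3.4.3)] -/
theorem _root_.Literature.AlgebraicGeometry.Resolution.IsRsopPart.isCleanAt_iff_forall
    (hzr : IsRsopPart z) {f : K}
    (hwild : ∃ i, conductorVector p z f i ≠ 0) :
    IsCleanAt p z f ↔ (∃ u, IsNormalForm p z f u) ∧
      ∀ u, IsNormalForm p z f u → rswForm z (conductorVector p z f) u ∉
        (maximalIdeal A • (⊤ : Submodule A (LogDifferential A z))) := by
  obtain ⟨i, hi⟩ := hwild
  constructor
  · intro h
    obtain ⟨u, hu, -⟩ := h.resolve_left (fun h' => hi (h' i))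
    exact ⟨⟨u, hu⟩, fun u' hu' => hzr.rswForm_not_mem_of_isCleanAt p h ⟨i, hi⟩ hu'⟩
  · rintro ⟨⟨u, hu⟩, hall⟩
    exact Or.inr ⟨u, hu, hall u hu⟩

end Regular

end Literature.AlgebraicGeometry.Ramification

end
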